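import Summits.Ventures.HodgeRepro2.T5HeisenbergCommutator

/-!
# T5BorelWittOne — the Borel subgroup of U(ℍ ⊕ ⟨a⟩) is `(T × U(1)) ⋉ N`, and `N` is its
derived subgroup (cell pub-hodge-repro2, seat p3)

Companion of `T5HeisenbergCommutator` (file 24) and of `T5BorelHyperbolic` (file 25, the `2 × 2`
case). For the three-dimensional hermitian space `V = ℍ ⊕ ⟨a⟩` (`J_a = !![0, 0, 1; 0, a, 0; 1, 0, 0]`,
`ā = a ≠ 0`) the BOREL `B = {g ∈ U(J_a) : g₁₀ = g₂₀ = g₂₁ = 0}` = the stabiliser of the isotropic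
line `⟨e₁⟩` (`mem_borelJ_iff_stabilizes` — in rank one the line stabiliser is already the Borel)
is analysed:

* `upper_relations`: the unitarity relations of an upper-triangular element;
* `exists_levi_mul_heis`: every `g ∈ B` is `d(g₀₀) · m(g₁₁) · n(y, z)` with `g₀₀ ≠ 0`,
  `ḡ₁₁ g₁₁ = 1` and `n(y, z) ∈ N` — `B = (T × U(1)) ⋉ N`;
* `leviHom : borelJ a →* Eˣ × Eˣ` (`g ↦ (g₀₀, g₁₁)`) with kernel exactly `N` (`mem_ker_leviHom_iff`);
* `commutator_borel_le_heis`: `[B, B] ≤ N`; `heis_le_commutator_borel`: `N ≤ [B, B]`;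
* `commutator_borel_eq_heis`: `[B, B] = N` (some `t ≠ 0` with `t̄ ≠ 1`, `t t̄ ≠ 1`);
* `character_borel_heis_eq_one`: every character of `B` is trivial on `N`.

Standard axioms; `3 × 3` matrices over an abstract star-field.
-/

namespace Summit.Ventures.HodgeRepro2.T5BorelWittOne

open Matrix
open scoped commutatorElement
open T5HeisenbergCommutator

variable {E : Type*} [Field E] [StarRing E]

/-- The `(i, j)` entry of an element of `U(J_a)`. -/
def entry {a : E} (g : unitaryJ a) (i j : Fin 3) : E :=
  ((g : GL (Fin 3) E) : Matrix (Fin 3) (Fin 3) E) i j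

/-- `entry g i j` is the entry of the underlying matrix. -/
theorem entry_eq {a : E} (g : unitaryJ a) (i j : Fin 3) :
    entry g i j = mat (g : GL (Fin 3) E) i j := rfl

/-- The entries of a product. -/
theorem entry_mul {a : E} (g h : unitaryJ a) (i j : Fin 3) :
    entry (g * h) i j =
      entry g i 0 * entry h 0 j + entry g i 1 * entry h 1 j + entry g i 2 * entry h 2 j := by
  simp only [entry, Subgroup.coe_mul, Units.val_mul, Matrix.mul_apply, Fin.sum_univ_three]

/-- The entries of `1`. -/
theorem entry_one {a : E} (i j : Fin 3) :
    entry (1 : unitaryJ a) i j = (1 : Matrix (Fin 3) (Fin 3) E) i j := rfl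

/-- `g⁻¹ * g = 1` entrywise. -/
theorem entry_inv_mul {a : E} (g : unitaryJ a) (i j : Fin 3) :
    entry g⁻¹ i 0 * entry g 0 j + entry g⁻¹ i 1 * entry g 1 j + entry g⁻¹ i 2 * entry g 2 j =
      (1 : Matrix (Fin 3) (Fin 3) E) i j := by
  rw [← entry_mul, inv_mul_cancel, entry_one]

/-- Upper-triangular: the three entries below the diagonal vanish. -/
def IsUpper {a : E} (g : unitaryJ a) : Prop :=
  entry g 1 0 = 0 ∧ entry g 2 0 = 0 ∧ entry g 2 1 = 0

/-- The matrix of an upper-triangular element, in terms of its entries. -/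
theorem mat_eq_upper {a : E} (g : unitaryJ a) (hg : IsUpper g) :
    mat (g : GL (Fin 3) E) =
      !![entry g 0 0, entry g 0 1, entry g 0 2; 0, entry g 1 1, entry g 1 2; 0, 0, entry g 2 2] := by
  obtain ⟨h10, h20, h21⟩ := hg
  have h10' : mat (g : GL (Fin 3) E) 1 0 = 0 := h10
  have h20' : mat (g : GL (Fin 3) E) 2 0 = 0 := h20
  have h21' : mat (g : GL (Fin 3) E) 2 1 = 0 := h21
  ext i j
  fin_cases i <;> fin_cases j <;> simp [entry_eq, h10', h20', h21']

/-- The unitarity relations of an upper-triangular element `!![α, p, q; 0, β, r; 0, 0, δ]` of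
`U(J_a)` (`ā = a`): `ᾱ δ = 1`, `a β̄ β = a`, `a β̄ r + p̄ δ = 0`, `δ̄ q + a r̄ r + q̄ δ = 0`. -/
theorem upper_relations {a : E} (g : unitaryJ a) (hg : IsUpper g) :
    star (entry g 0 0) * entry g 2 2 = 1 ∧
      a * star (entry g 1 1) * entry g 1 1 = a ∧
      a * star (entry g 1 1) * entry g 1 2 + star (entry g 0 1) * entry g 2 2 = 0 ∧
      star (entry g 2 2) * entry g 0 2 + a * star (entry g 1 2) * entry g 1 2 +
        star (entry g 0 2) * entry g 2 2 = 0 := by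
  have hrel := (mem_unitaryJ_iff a (g : GL (Fin 3) E)).mp g.2
  rw [mat_eq_upper g hg, formJ, conjTranspose_fin_three, Matrix.mul_fin_three,
    Matrix.mul_fin_three] at hrel
  simp only [star_zero, mul_zero, zero_mul, add_zero, zero_add, mul_one] at hrel
  refine ⟨?_, ?_, ?_, ?_⟩
  · have := congrFun (congrFun hrel 0) 2
    simpa using this
  · have := congrFun (congrFun hrel 1) 1
    simp at this
    linear_combination this
  · have := congrFun (congrFun hrel 1) 2
    simp at this
    linear_combination this
  · have := congrFun (congrFun hrel 2) 2
    simp at this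
    linear_combination this

/-- The `(0, 0)` entry of an upper-triangular element of `U(J_a)` is non-zero. -/
theorem entry_00_ne_zero {a : E} (g : unitaryJ a) (hg : IsUpper g) :
    entry g 0 0 ≠ 0 := by
  intro h0
  have h := (upper_relations g hg).1
  rw [h0, star_zero, zero_mul] at h
  exact zero_ne_one h

/-- The `(1, 1)` entry of an upper-triangular element of `U(J_a)` has norm one (`a ≠ 0`). -/
theorem entry_11_norm {a : E} (ha0 : a ≠ 0) (g : unitaryJ a) (hg : IsUpper g) :
    star (entry g 1 1) * entry g 1 1 = 1 := by
  have h := (upper_relations g hg).2.1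
  have : a * (star (entry g 1 1) * entry g 1 1) = a * 1 := by rw [mul_one, ← mul_assoc, h]
  exact mul_left_cancel₀ ha0 this

/-- The `(1, 1)` entry of an upper-triangular element of `U(J_a)` is non-zero (`a ≠ 0`). -/
theorem entry_11_ne_zero {a : E} (ha0 : a ≠ 0) (g : unitaryJ a) (hg : IsUpper g) :
    entry g 1 1 ≠ 0 := by
  intro h0
  have h := entry_11_norm ha0 g hg
  rw [h0, mul_zero] at h
  exact zero_ne_one h

/-- The Borel subgroup of `U(J_a)` (`a ≠ 0`): the upper-triangular elements. -/
def borelJ (a : E) (ha0 : a ≠ 0) : Subgroup (unitaryJ a) where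
  carrier := {g | IsUpper g}
  one_mem' := by
    show IsUpper (1 : unitaryJ a)
    refine ⟨?_, ?_, ?_⟩ <;> (rw [entry_one]; simp)
  mul_mem' := by
    intro g h hg hh
    obtain ⟨g10, g20, g21⟩ := hg
    obtain ⟨h10, h20, h21⟩ := hh
    refine ⟨?_, ?_, ?_⟩
    · rw [entry_mul, g10, h10, h20]; ring
    · rw [entry_mul, g20, g21, h20]; ring
    · rw [entry_mul, g20, g21, h21]; ring
  inv_mem' := by
    intro g hg
    obtain ⟨g10, g20, g21⟩ := hg
    have hα : entry g 0 0 ≠ 0 := entry_00_ne_zero g ⟨g10, g20, g21⟩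
    have hβ : entry g 1 1 ≠ 0 := entry_11_ne_zero ha0 g ⟨g10, g20, g21⟩
    -- from `g⁻¹ g = 1` at the entries `(1, 0)`, `(2, 0)`, `(2, 1)`
    have e10 := entry_inv_mul g 1 0
    have e20 := entry_inv_mul g 2 0
    have e21 := entry_inv_mul g 2 1
    rw [g10, g20] at e10 e20
    rw [g21] at e21
    simp only [mul_zero, add_zero, Matrix.one_apply_ne (show (1 : Fin 3) ≠ 0 by decide),
      Matrix.one_apply_ne (show (2 : Fin 3) ≠ 0 by decide),
      Matrix.one_apply_ne (show (2 : Fin 3) ≠ 1 by decide)] at e10 e20 e21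
    have i10 : entry g⁻¹ 1 0 = 0 := (mul_eq_zero.mp e10).resolve_right hα
    have i20 : entry g⁻¹ 2 0 = 0 := (mul_eq_zero.mp e20).resolve_right hα
    rw [i20, zero_mul, zero_add] at e21
    have i21 : entry g⁻¹ 2 1 = 0 := (mul_eq_zero.mp e21).resolve_right hβ
    exact ⟨i10, i20, i21⟩

/-- Membership in the Borel. -/
theorem mem_borelJ_iff {a : E} (ha0 : a ≠ 0) (g : unitaryJ a) :
    g ∈ borelJ a ha0 ↔ IsUpper g := Iff.rfl

/-- In `U(J_a)` (rank one) the stabiliser of the isotropic line `⟨e₁⟩` is already the Borel: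
`g ∈ B` if and only if `g e₁ ∈ E e₁`. -/
theorem mem_borelJ_iff_stabilizes {a : E} (ha0 : a ≠ 0) (g : unitaryJ a) :
    g ∈ borelJ a ha0 ↔ ∃ c : E, (mat (g : GL (Fin 3) E)).mulVec ![1, 0, 0] = c • ![1, 0, 0] := by
  rw [mem_borelJ_iff]
  constructor
  · rintro ⟨g10, g20, _⟩
    refine ⟨entry g 0 0, ?_⟩
    have h10 : mat (g : GL (Fin 3) E) 1 0 = 0 := g10
    have h20 : mat (g : GL (Fin 3) E) 2 0 = 0 := g20
    ext i
    fin_cases i <;> simp [Matrix.mulVec, dotProduct, Fin.sum_univ_three, entry_eq, h10, h20]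
  · rintro ⟨c, hc⟩
    have h1 := congrFun hc 1
    have h2 := congrFun hc 2
    simp [Matrix.mulVec, dotProduct, Fin.sum_univ_three] at h1 h2
    have g10 : entry g 1 0 = 0 := h1
    have g20 : entry g 2 0 = 0 := h2
    -- the third vanishing entry `g₂₁ = 0` follows from the unitarity relations: with
    -- `g₁₀ = g₂₀ = 0` the `(0, 1)`-entry of `gᴴ J_a g = J_a` reads `ḡ₀₀ g₂₁ = 0` and `g₀₀ ≠ 0`
    have hrel := (mem_unitaryJ_iff a (g : GL (Fin 3) E)).mp g.2
    have h10 : mat (g : GL (Fin 3) E) 1 0 = 0 := g10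
    have h20 : mat (g : GL (Fin 3) E) 2 0 = 0 := g20
    have hmat : mat (g : GL (Fin 3) E) =
        !![entry g 0 0, entry g 0 1, entry g 0 2; 0, entry g 1 1, entry g 1 2;
          0, entry g 2 1, entry g 2 2] := by
      ext i j
      fin_cases i <;> fin_cases j <;> simp [entry_eq, h10, h20]
    rw [hmat, formJ, conjTranspose_fin_three, Matrix.mul_fin_three, Matrix.mul_fin_three] at hrel
    have h01 := congrFun (congrFun hrel 0) 1
    have h02 := congrFun (congrFun hrel 0) 2
    simp at h01 h02
    -- `h02 : ḡ₀₀ g₂₂ = 1` gives `g₀₀ ≠ 0`; `h01 : g₀₀ = 0 ∨ g₂₁ = 0` gives `g₂₁ = 0`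
    have hα : entry g 0 0 ≠ 0 := by
      intro h
      rw [h] at h02
      simp at h02
    exact ⟨g10, g20, h01.resolve_left hα⟩

/-- The Levi element `m(β) = diag(1, β, 1)` (`β̄ β = 1`). -/
def leviUnit (β : E) (hβ : star β * β = 1) : GL (Fin 3) E where
  val := !![1, 0, 0; 0, β, 0; 0, 0, 1]
  inv := !![1, 0, 0; 0, star β, 0; 0, 0, 1]
  val_inv := by
    have : β * star β = 1 := by rw [mul_comm]; exact hβ
    simp [Matrix.one_fin_three, this]
  inv_val := by simp [Matrix.one_fin_three, hβ]

/-- The underlying matrix of `leviUnit β`. -/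
@[simp]
theorem leviUnit_val (β : E) (hβ : star β * β = 1) :
    mat (leviUnit β hβ) = !![1, 0, 0; 0, β, 0; 0, 0, 1] := rfl

/-- `m(β) ∈ U(J_a)`. -/
theorem leviUnit_mem_unitaryJ (a β : E) (hβ : star β * β = 1) : leviUnit β hβ ∈ unitaryJ a := by
  have h2 : star β * (a * β) = a := by rw [mul_left_comm, hβ, mul_one]
  rw [mem_unitaryJ_iff, leviUnit_val, formJ, conjTranspose_fin_three, Matrix.mul_fin_three,
    Matrix.mul_fin_three]
  simp [mul_assoc, h2]

/-- The `(0, 1)` entry of an upper-triangular element: `p = -a β r̄ α`. -/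
theorem entry_01_eq {a : E} (ha : star a = a) (g : unitaryJ a) (hg : IsUpper g) :
    entry g 0 1 = -(a * entry g 1 1 * star (entry g 1 2) * entry g 0 0) := by
  obtain ⟨h02, -, h12, -⟩ := upper_relations g hg
  have hα : entry g 0 0 ≠ 0 := entry_00_ne_zero g hg
  have hsα : star (entry g 0 0) ≠ 0 := star_ne_zero.mpr hα
  have hδ : entry g 2 2 = (star (entry g 0 0))⁻¹ := by
    field_simp
    linear_combination h02
  rw [hδ] at h12
  have hsp : star (entry g 0 1) = -(a * star (entry g 1 1) * entry g 1 2 * star (entry g 0 0)) := by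
    field_simp at h12
    linear_combination h12
  rw [← star_star (entry g 0 1), hsp]
  simp only [star_neg, star_mul, star_star, ha]
  ring

/-- Every element of the Borel factors as `d(α) · m(β) · n(y, z)` with `α = g₀₀ ≠ 0`,
`β = g₁₁` of norm one and `n(y, z) ∈ N` — `B = (T × U(1)) ⋉ N`. -/
theorem exists_levi_mul_heis {a : E} (ha : star a = a) (ha0 : a ≠ 0) (g : unitaryJ a)
    (hg : g ∈ borelJ a ha0) :
    ∃ (α : E) (hα : α ≠ 0) (β : E) (hβ : star β * β = 1) (y z : E),
      z + star z + a * star y * y = 0 ∧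
        (g : GL (Fin 3) E) = diagUnit α hα * leviUnit β hβ * heisUnit a y z := by
  have hg' : IsUpper g := hg
  obtain ⟨h02, -, -, h22⟩ := upper_relations g hg'
  have hα : entry g 0 0 ≠ 0 := entry_00_ne_zero g hg'
  have hsα : star (entry g 0 0) ≠ 0 := star_ne_zero.mpr hα
  have hβ : star (entry g 1 1) * entry g 1 1 = 1 := entry_11_norm ha0 g hg'
  have hβ' : entry g 1 1 * star (entry g 1 1) = 1 := by rw [mul_comm]; exact hβ
  have hδ : entry g 2 2 = (star (entry g 0 0))⁻¹ := by
    field_simp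
    linear_combination h02
  have hp := entry_01_eq ha g hg'
  -- `y := β̄ r`, `z := α⁻¹ q`
  refine ⟨entry g 0 0, hα, entry g 1 1, hβ, star (entry g 1 1) * entry g 1 2,
    (entry g 0 0)⁻¹ * entry g 0 2, ?_, ?_⟩
  · -- the trace condition is `δ̄ q + a r̄ r + q̄ δ = 0` with `δ = ᾱ⁻¹`, up to `β β̄ = 1`
    rw [hδ, star_inv₀, star_star] at h22
    simp only [star_mul, star_inv₀, star_star]
    linear_combination h22 + (a * star (entry g 1 2) * entry g 1 2) * hβ'
  · ext : 1
    show mat (g : GL (Fin 3) E) = mat (diagUnit (entry g 0 0) hα * leviUnit (entry g 1 1) hβ *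
      heisUnit a _ _)
    rw [mat_eq_upper g hg', mat_mul, mat_mul, diagUnit_val, leviUnit_val, heisUnit_val,
      T5HeisenbergCommutator.diag, heis, Matrix.mul_fin_three, Matrix.mul_fin_three, hδ, hp]
    congr 1
    funext i j
    fin_cases i <;> fin_cases j <;>
      simp [star_mul, star_star, mul_inv_cancel_left₀ hα] <;>
      first
      | ring1
      | linear_combination (-(entry g 1 2)) * hβ'

/-- The homomorphism `B → Eˣ × Eˣ`, `g ↦ (g₀₀, g₁₁)` (the Levi quotient of the Borel). -/
def leviHom (a : E) (ha0 : a ≠ 0) : borelJ a ha0 →* Eˣ × Eˣ where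
  toFun g := (Units.mk0 (entry g.1 0 0) (entry_00_ne_zero g.1 g.2),
    Units.mk0 (entry g.1 1 1) (entry_11_ne_zero ha0 g.1 g.2))
  map_one' := by
    ext <;> simp [entry_one]
  map_mul' g h := by
    obtain ⟨g10, -, -⟩ := g.2
    obtain ⟨h10, h20, h21⟩ := h.2
    ext
    · simp only [Units.val_mk0, Prod.fst_mul, Units.val_mul, Subgroup.coe_mul, entry_mul, h10, h20]
      ring
    · simp only [Units.val_mk0, Prod.snd_mul, Units.val_mul, Subgroup.coe_mul, entry_mul, g10, h21]
      ring

/-- The value of `leviHom`. -/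
theorem leviHom_apply {a : E} (ha0 : a ≠ 0) (g : borelJ a ha0) :
    ((leviHom a ha0 g).1 : E) = entry g.1 0 0 ∧ ((leviHom a ha0 g).2 : E) = entry g.1 1 1 :=
  ⟨rfl, rfl⟩

/-- `leviHom g = 1` if and only if `g₀₀ = 1` and `g₁₁ = 1`. -/
theorem leviHom_eq_one_iff {a : E} (ha0 : a ≠ 0) (g : borelJ a ha0) :
    leviHom a ha0 g = 1 ↔ entry g.1 0 0 = 1 ∧ entry g.1 1 1 = 1 := by
  constructor
  · intro h
    have h1 := congrArg (fun p : Eˣ × Eˣ => (p.1 : E)) h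
    have h2 := congrArg (fun p : Eˣ × Eˣ => (p.2 : E)) h
    simp only [Prod.fst_one, Prod.snd_one, Units.val_one] at h1 h2
    exact ⟨h1, h2⟩
  · rintro ⟨h1, h2⟩
    ext
    · simpa [leviHom] using h1
    · simpa [leviHom] using h2

/-- The kernel of `leviHom` consists exactly of the Heisenberg elements `n(y, z) ∈ N`. -/
theorem mem_ker_leviHom_iff {a : E} (ha : star a = a) (ha0 : a ≠ 0) (g : borelJ a ha0) :
    g ∈ (leviHom a ha0).ker ↔
      ∃ y z : E, z + star z + a * star y * y = 0 ∧
        ((g : unitaryJ a) : GL (Fin 3) E) = heisUnit a y z := by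
  rw [MonoidHom.mem_ker, leviHom_eq_one_iff]
  constructor
  · rintro ⟨h00, h11⟩
    obtain ⟨α, hα, β, hβ, y, z, hyz, hg⟩ := exists_levi_mul_heis ha ha0 g.1 g.2
    have hm := congrArg mat hg
    rw [mat_mul, mat_mul, diagUnit_val, leviUnit_val, heisUnit_val, T5HeisenbergCommutator.diag,
      heis, Matrix.mul_fin_three, Matrix.mul_fin_three] at hm
    have hα1 : α = 1 := by
      have := congrFun (congrFun hm 0) 0
      rw [← entry_eq, h00] at this
      simpa using this.symm
    have hβ1 : β = 1 := by
      have := congrFun (congrFun hm 1) 1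
      rw [← entry_eq, h11] at this
      simpa using this.symm
    subst hα1 hβ1
    refine ⟨y, z, hyz, ?_⟩
    rw [hg]
    apply Units.ext
    show mat (diagUnit 1 hα * leviUnit 1 hβ * heisUnit a y z) = mat (heisUnit a y z)
    rw [mat_mul, mat_mul, diagUnit_val, leviUnit_val, T5HeisenbergCommutator.diag, star_one,
      inv_one, ← Matrix.one_fin_three, Matrix.one_mul, Matrix.one_mul]
  · rintro ⟨y, z, -, hg⟩
    have hm := congrArg mat hg
    constructor
    · rw [entry_eq, hm, heisUnit_val, heis]
      simp
    · rw [entry_eq, hm, heisUnit_val, heis]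
      simp

/-- The commutator subgroup of the Borel lies in the kernel of `leviHom`, i.e. in `N`. -/
theorem commutator_borel_le_heis (a : E) (ha0 : a ≠ 0) :
    commutator (borelJ a ha0) ≤ (leviHom a ha0).ker :=
  Abelianization.commutator_subset_ker (leviHom a ha0)

/-- Every element of `N` is a commutator of the Borel (file 24's identity, read inside `B`),
as soon as some `t ≠ 0` has `t̄ ≠ 1` and `t t̄ ≠ 1`. -/
theorem heis_le_commutator_borel (a : E) (ha : star a = a) (ha0 : a ≠ 0) (t : E) (ht : t ≠ 0)
    (ht1 : star t ≠ 1) (ht2 : t * star t ≠ 1) :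
    (leviHom a ha0).ker ≤ commutator (borelJ a ha0) := by
  intro g hg
  obtain ⟨y₀, z₀, h0, hg0⟩ := (mem_ker_leviHom_iff ha ha0 g).mp hg
  have hpre := preimage_mem a ha t ht1 ht2 y₀ z₀ h0
  simp only at hpre
  have hdU : diagUnit t ht ∈ unitaryJ a := diagUnit_mem_unitaryJ a t ht
  have hnU : heisUnit a (y₀ / (star t - 1))
      ((z₀ - a * (t - 1) * star (y₀ / (star t - 1)) * (y₀ / (star t - 1))) / (t * star t - 1)) ∈
        unitaryJ a :=
    (heisUnit_mem_unitaryJ_iff a ha _ _).mpr hpre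
  have hdB : (⟨diagUnit t ht, hdU⟩ : unitaryJ a) ∈ borelJ a ha0 := by
    refine ⟨?_, ?_, ?_⟩ <;> (rw [entry_eq]; simp [T5HeisenbergCommutator.diag])
  have hnB : (⟨_, hnU⟩ : unitaryJ a) ∈ borelJ a ha0 := by
    refine ⟨?_, ?_, ?_⟩ <;> (rw [entry_eq]; simp [heis])
  have heq : g = ⁅(⟨⟨diagUnit t ht, hdU⟩, hdB⟩ : borelJ a ha0), ⟨⟨_, hnU⟩, hnB⟩⁆ := by
    apply Subtype.ext
    apply Subtype.ext
    have h := heisUnit_eq_commutator a t ht ht1 ht2 y₀ z₀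
    rw [commutatorElement_def] at h
    rw [hg0, commutatorElement_def, Subgroup.coe_mul, Subgroup.coe_mul, Subgroup.coe_mul,
      Subgroup.coe_inv, Subgroup.coe_inv, Subgroup.coe_mul, Subgroup.coe_mul, Subgroup.coe_mul,
      Subgroup.coe_inv, Subgroup.coe_inv]
    exact h
  rw [heq]
  exact Subgroup.commutator_mem_commutator (Subgroup.mem_top _) (Subgroup.mem_top _)

/-- `[B, B] = N`: the derived subgroup of the Borel of `U(J_a)` is exactly the kernel of the Levi
quotient, i.e. the Heisenberg radical. -/
theorem commutator_borel_eq_heis (a : E) (ha : star a = a) (ha0 : a ≠ 0) (t : E) (ht : t ≠ 0)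
    (ht1 : star t ≠ 1) (ht2 : t * star t ≠ 1) :
    commutator (borelJ a ha0) = (leviHom a ha0).ker :=
  le_antisymm (commutator_borel_le_heis a ha0) (heis_le_commutator_borel a ha ha0 t ht ht1 ht2)

/-- Every character of the Borel of `U(J_a)` with values in a commutative group is trivial on `N`. -/
theorem character_borel_heis_eq_one {A : Type*} [CommGroup A] (a : E) (ha : star a = a)
    (ha0 : a ≠ 0) (χ : borelJ a ha0 →* A) (t : E) (ht : t ≠ 0) (ht1 : star t ≠ 1)
    (ht2 : t * star t ≠ 1) (g : borelJ a ha0) (hg : g ∈ (leviHom a ha0).ker) : χ g = 1 :=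
  MonoidHom.mem_ker.mp
    (Abelianization.commutator_subset_ker χ (heis_le_commutator_borel a ha ha0 t ht ht1 ht2 hg))

end Summit.Ventures.HodgeRepro2.T5BorelWittOne
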